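import Summits.AnomalousDissipation.AnomalousDissipation.Theorems.SolenoidalFractalHomogenisationRealisedQuasiStaticCellLawPrincipalCosetEnergy
import HarnessLib

/-!
# K2R `RealisedQuasiStaticCellLaw`, line `floquet-bloch`: geometry of a principal coset — conjugate cosets carry equal energy,
# and the Leray cosines are the cosines between consecutive coset frequencies (helper towards `stub_lowSectorDecay` /
# `stub_upperSome`; `--supports stmt-AnomalousDissipation-20446`)

Summits-side helper file (everything proved; no definitions, no named facts).
* `norm_galerkinCoeffAt_neg`: the Galerkin state is conjugate symmetric, so `‖α_N(t)(-k)‖ = ‖α_N(t)(k)‖` — the two principal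
  cosets `±ℓ′ + ℤK_j` of a Bloch sector carry the same energy (treat the one with positive coupling `ê_j·k₀ > 0`, double).
* `inPlane_link_eq_cos`: for the in-plane frame `p_J = |k_J|⁻¹ k_J × ζ` (`ζ` unit, normal to the coset plane) the links of
  `inPlane_block_decay` are `p_J·p_{J'} = k̂_J·k̂_{J'}` (`cross_dot_cross`): in particular
  `γ² = (k̂₀·k̂₁)² + (k̂₋₁·k̂₀)²`, the squared cosines between consecutive frequencies of the coset (≈ `2(q̂·m̂_j)²` when
  `|k₀| ≪ |K_j|`, STUB-PLAN `stub_lowSectorDecay` §1 «γ_j = |q̂·m̂_j|»; recipe H4).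
-/

set_option linter.dupNamespace false

noncomputable section

namespace Summit.AnomalousDissipation.AnomalousDissipation.Theorems.SolenoidalFractalHomogenisation.RealisedQuasiStaticCellLaw

open Set MeasureTheory Filter Topology Function Matrix
open scoped InnerProductSpace ComplexConjugate Matrix
open Literature.Analysis Literature.Analysis.FunctionSpaces Literature.Analysis.FunctionSpaces.Torus
open Literature.Analysis.FluidPDE Literature.Analysis.FluidPDE.LatticeShear

variable {k₀ : ℕ}

/-- **Conjugate cosets carry equal energy**: `‖α_N(t)(-k)‖ = ‖α_N(t)(k)‖` for the Galerkin truncations of the cell problem. -/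
theorem norm_galerkinCoeffAt_neg (W : LatticeWord k₀) {n : ℕ} (hn : 0 < n) {κ : ℝ} (hκ : 0 ≤ κ)
    (ℓ : Fin 3 → ℤ) {w₀ : UnitAddTorus (Fin 3) → EuclideanSpace ℝ (Fin 3)}
    (hw₀ : FunctionSpaces.Torus.MemSobolev 1 (FunctionSpaces.EuclideanSpace.complexify ∘ w₀))
    (hdiv : FunctionSpaces.Torus.IsWeaklyDivFree w₀) (hmean : FunctionSpaces.Torus.HasZeroMean w₀)
    (hsupp : ∀ k : Fin 3 → ℤ, ¬ ((∃ z : Fin 3 → ℤ, k = ℓ + (n:ℤ) • z) ∨ (∃ z : Fin 3 → ℤ, k = -ℓ + (n:ℤ) • z)) →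
      UnitAddTorus.mFourierCoeff (FunctionSpaces.EuclideanSpace.complexify ∘ w₀) k = 0)
    (N : ℕ) (t : ℝ) (k : Fin 3 → ℤ) :
    ‖(pvSetup_cell W hn hκ ℓ hw₀ hdiv hmean hsupp).galerkinCoeffAt N t (-k)‖ =
      ‖(pvSetup_cell W hn hκ ℓ hw₀ hdiv hmean hsupp).galerkinCoeffAt N t k‖ := by
  rw [(pvSetup_cell W hn hκ ℓ hw₀ hdiv hmean hsupp).isConjSymm_galerkinCoeffAt N t k, EuclideanSpace.norm_conjVec]

/-- **Block energies of conjugate cosets agree**: summing over any finite set of modes, the energies at `-k` and `k` agree. -/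
theorem sum_norm_sq_galerkinCoeffAt_neg (W : LatticeWord k₀) {n : ℕ} (hn : 0 < n) {κ : ℝ} (hκ : 0 ≤ κ)
    (ℓ : Fin 3 → ℤ) {w₀ : UnitAddTorus (Fin 3) → EuclideanSpace ℝ (Fin 3)}
    (hw₀ : FunctionSpaces.Torus.MemSobolev 1 (FunctionSpaces.EuclideanSpace.complexify ∘ w₀))
    (hdiv : FunctionSpaces.Torus.IsWeaklyDivFree w₀) (hmean : FunctionSpaces.Torus.HasZeroMean w₀)
    (hsupp : ∀ k : Fin 3 → ℤ, ¬ ((∃ z : Fin 3 → ℤ, k = ℓ + (n:ℤ) • z) ∨ (∃ z : Fin 3 → ℤ, k = -ℓ + (n:ℤ) • z)) →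
      UnitAddTorus.mFourierCoeff (FunctionSpaces.EuclideanSpace.complexify ∘ w₀) k = 0)
    (N : ℕ) (t : ℝ) {ι : Type*} (s : Finset ι) (k : ι → Fin 3 → ℤ) :
    ∑ i ∈ s, ‖(pvSetup_cell W hn hκ ℓ hw₀ hdiv hmean hsupp).galerkinCoeffAt N t (-(k i))‖ ^ 2 =
      ∑ i ∈ s, ‖(pvSetup_cell W hn hκ ℓ hw₀ hdiv hmean hsupp).galerkinCoeffAt N t (k i)‖ ^ 2 :=
  Finset.sum_congr rfl fun i _ => by rw [norm_galerkinCoeffAt_neg W hn hκ ℓ hw₀ hdiv hmean hsupp]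

/-- **The Leray cosines are cosines between coset frequencies**: for a unit `ζ` normal to both `k` and `k'`,
`(|k|⁻¹ k × ζ)·(|k'|⁻¹ k' × ζ) = |k|⁻¹|k'|⁻¹ (k·k')`. -/
theorem inPlane_link_eq_cos (k k' : Fin 3 → ℤ) {ζr : Fin 3 → ℝ} (hζ1 : ζr ⬝ᵥ ζr = 1)
    (hζk : ζr ⬝ᵥ (fun i => ((k i : ℤ) : ℝ)) = 0) (hζk' : ζr ⬝ᵥ (fun i => ((k' i : ℤ) : ℝ)) = 0) :
    ((Real.sqrt ((fun i => ((k i : ℤ) : ℝ)) ⬝ᵥ (fun i => ((k i : ℤ) : ℝ))))⁻¹ • (fun i => ((k i : ℤ) : ℝ)) ⨯₃ ζr) ⬝ᵥ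
      ((Real.sqrt ((fun i => ((k' i : ℤ) : ℝ)) ⬝ᵥ (fun i => ((k' i : ℤ) : ℝ))))⁻¹ • (fun i => ((k' i : ℤ) : ℝ)) ⨯₃ ζr) =
      (Real.sqrt ((fun i => ((k i : ℤ) : ℝ)) ⬝ᵥ (fun i => ((k i : ℤ) : ℝ))))⁻¹ *
        (Real.sqrt ((fun i => ((k' i : ℤ) : ℝ)) ⬝ᵥ (fun i => ((k' i : ℤ) : ℝ))))⁻¹ *
        ((fun i => ((k i : ℤ) : ℝ)) ⬝ᵥ (fun i => ((k' i : ℤ) : ℝ))) := by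
  have h1 : (fun i => ((k i : ℤ) : ℝ)) ⬝ᵥ ζr = 0 := by rw [dotProduct_comm]; exact hζk
  rw [smul_dotProduct, dotProduct_smul, cross_dot_cross, hζ1, h1, hζk', smul_eq_mul, smul_eq_mul]
  ring

end Summit.AnomalousDissipation.AnomalousDissipation.Theorems.SolenoidalFractalHomogenisation.RealisedQuasiStaticCellLaw

end
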